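import Summits.CriticalPhenomena.Ising3DConformalLimit.Theses.ReflectionTwin
import Literature.Probability.LatticeModels.GaussianPairingBoundCouplings
import Literature.Probability.LatticeModels.CorrelationInequalitiesProofs
import Literature.Probability.LatticeModels.IsingEffectiveField
import HarnessLib

/-!
# Stub `stub_seamLebowitzIncrement` of line `replica-mirror` (crux `ReflectionTwin.TwinTransparency`, stmt-CriticalPhenomena-16905)

The finite-volume LEBOWITZ DIFFERENTIAL INEQUALITY IN THE SEAM COUPLING of the (111) reflection twin `TW(J)` of `ℤ³`
at bulk `β_c(3)` (lemma K1 of idea `threshold-lebowitz-calculus`): on `Λ_L = box 3 L` the pair couplings are `β_c/2`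
on the lattice bonds not joining the layers `h = 0, 1` (`h z = z₀+z₁+z₂`) and on the twin bonds `{c, x}` (`h c = 0`,
`h x = 1`, `c + x = eᵢ`), times `J` on every bond with an endpoint on the plane `h = 0`. With the slab `T = {|h| ≤ 1}`
and `χ_a(J) := Σ_{b ∈ T ∩ Λ_L} ⟨σ_aσ_b⟩_J`: if `0 ≤ J₁ ≤ J₂` and `χ_b(J₂) ≤ M` on `T`, then
`χ_a(J₂) - χ_a(J₁) ≤ 12 β_c (J₂ - J₁) M²` for `a ∈ T` (`stub_seamLebowitzIncrement`, registered signature).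

Proof. (1) `c_J = K + J W` entrywise, `K, W ≥ 0`, `W` = the bonds touching the plane, all with both endpoints in `T`
(`slab_of_seam`); through the `rfl` bridge `PairIsing.gibbsAvg = PairIsing.avg` and `PairIsing.avg_eq_gksExpect` the
box state is `ν_{Λ;K+JW}` of `GKSInequalities` (index set `Λ × Λ`, pair supports), so
`dχ_a/dJ = Σ_b Σ_{(u,v)} W_{uv} ⟨σ_aσ_b; σ_uσ_v⟩_J` (`hasDerivAt_gksExpect_affCpl_cov`, Glimm–Jaffe Prop. 4.2.1).
(2) Lebowitz `u₄ ≤ 0` (`gksExpect_connectedFour_nonpos`): `Σ_b ⟨σ_aσ_b;σ_uσ_v⟩ ≤ ⟨σ_aσ_u⟩χ_v + ⟨σ_aσ_v⟩χ_u`, and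
`χ(J) ≤ χ(J₂) ≤ M` on `T` by Griffiths' comparison (`gksExpect_mono_of_abs_le`). (3) A site has at most `9` partners
(`6` lattice neighbours `w ∓ eᵢ`, `3` twin partners `eᵢ - w`; `card_partners_le`), so `dχ_a/dJ ≤ 9 β_c M χ_a ≤ 9 β_c M²`.
(4) Mean value inequality on `[J₁, J₂]`, and `9 ≤ 12`. (1)(2)(4): abstract finite set and affine path
(`slabSum_sub_le_of_path`); (3): abstract adjacency (`slab_increment_le`). Sources: Glimm–Jaffe, *Quantum Physics*
(1987) §4.2, Cor. 4.3.3; Duminil-Copin ICM 2022 §7.1; Friedli–Velenik (2017) Thm. 3.49, Ex. 3.31. No defs, no named facts.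
-/

noncomputable section

namespace Summit.CriticalPhenomena.Ising3DConformalLimit.Cruxes.TwinTransparency.ReplicaMirror

open scoped BigOperators Topology Manifold Classical MeasureTheory ProbabilityTheory Matrix InnerProductSpace ComplexConjugate ContinuousMap
open Filter Set Function TopologicalSpace MeasureTheory
open Literature.Probability.LatticeModels

/-! ## §1 Affine pair-coupling paths on a finite set: derivative, Lebowitz, GKS, mean value inequality -/

section PathCalculus

variable {V : Type*} [Fintype V] [DecidableEq V]

omit [Fintype V] in
/-- `σ_xσ_y` is a spin product `σ_A` (`A = {x,y}`, or `∅` if `x = y`). [folklore] -/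
private theorem exists_spinPair_eq_spinProduct (x y : V) : ∃ A : Finset V, spinPair x y = spinProduct A := by
  by_cases h : x = y
  · subst h
    exact ⟨∅, by rw [spinPair_self]; funext ω; simp [spinProduct]⟩
  · exact ⟨{x, y}, (spinProduct_pair_eq_spinPair h).symm⟩

omit [Fintype V] in
/-- The pair supports `C_{(u,v)} = {u,v}` (`∅` on the diagonal) have at most two sites and even cardinality. [folklore] -/
private theorem pairSupp_card (q : V × V) : (if q.1 = q.2 then (∅ : Finset V) else {q.1, q.2}).card ≤ 2 ∧
    Even (if q.1 = q.2 then (∅ : Finset V) else {q.1, q.2}).card := by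
  split_ifs with h
  exacts [by simp, by rw [Finset.card_pair h]; exact ⟨le_rfl, even_two⟩]

/-- GKS I along the path `⟨·⟩_{Λ;K+JW}` (written `E J`): `⟨σ_xσ_y⟩ ≥ 0` for `K, W, J ≥ 0`.
[cite: FriedliVelenik2017, Thm. 3.49, eq. (3.54)] -/
private theorem gksE_spinPair_nonneg {K W : V × V → ℝ} {E : ℝ → (SpinConfig V → ℝ) → ℝ}
    (hE : ∀ J f, E J f = gksExpect Finset.univ (affCpl K W J) (fun p => if p.1 = p.2 then ∅ else {p.1, p.2}) f)
    (hK : ∀ p, 0 ≤ K p) (hW : ∀ p, 0 ≤ W p) {J : ℝ} (hJ : 0 ≤ J) (x y : V) : 0 ≤ E J (spinPair x y) := by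
  obtain ⟨A, hA⟩ := exists_spinPair_eq_spinProduct x y
  rw [hE, hA]
  exact gksExpect_spinProduct_nonneg _ _ _ (fun p _ => add_nonneg (hK p) (mul_nonneg hJ (hW p))) A

/-- Griffiths' comparison along the path: `⟨σ_xσ_y⟩_{K+JW} ≤ ⟨σ_xσ_y⟩_{K+J'W}` for `0 ≤ J ≤ J'` (`|K + JW| ≤ K + J'W`).
[cite: FriedliVelenik2017, Exercise 3.31, p. 142] -/
private theorem gksE_spinPair_mono {K W : V × V → ℝ} {E : ℝ → (SpinConfig V → ℝ) → ℝ}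
    (hE : ∀ J f, E J f = gksExpect Finset.univ (affCpl K W J) (fun p => if p.1 = p.2 then ∅ else {p.1, p.2}) f)
    (hK : ∀ p, 0 ≤ K p) (hW : ∀ p, 0 ≤ W p) {J J' : ℝ} (hJ : 0 ≤ J) (hJJ' : J ≤ J') (x y : V) :
    E J (spinPair x y) ≤ E J' (spinPair x y) := by
  obtain ⟨A, hA⟩ := exists_spinPair_eq_spinProduct x y
  rw [hE, hE, hA]
  refine gksExpect_mono_of_abs_le _ _ (fun p _ => ?_) A
  show |K p + J * W p| ≤ K p + J' * W p
  rw [abs_of_nonneg (add_nonneg (hK p) (mul_nonneg hJ (hW p)))]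
  exact add_le_add le_rfl (mul_le_mul_of_nonneg_right hJJ' (hW p))

/-- **Lebowitz, summed over the slab**: for `J ≥ 0` and an ordered pair `p = (u,v)`,
`Σ_{b ∈ T} ⟨σ_aσ_b; σ_{C_p}⟩ ≤ ⟨σ_aσ_u⟩ Σ_{b∈T} ⟨σ_vσ_b⟩ + ⟨σ_aσ_v⟩ Σ_{b∈T} ⟨σ_uσ_b⟩` (`u₄ ≤ 0` at zero field, the
pair supports being even; on the diagonal `σ_{C_p} = 1` and the covariance vanishes). [cite: GlimmJaffe1987, Cor. 4.3.3] -/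
private theorem sum_cov_le {K W : V × V → ℝ} {E : ℝ → (SpinConfig V → ℝ) → ℝ}
    (hE : ∀ J f, E J f = gksExpect Finset.univ (affCpl K W J) (fun p => if p.1 = p.2 then ∅ else {p.1, p.2}) f)
    (hK : ∀ p, 0 ≤ K p) (hW : ∀ p, 0 ≤ W p) {J : ℝ} (hJ : 0 ≤ J) (T : Finset V) (a : V) (p : V × V) :
    ∑ b ∈ T, (E J (fun ω => spinPair a b ω * spinProduct (if p.1 = p.2 then ∅ else {p.1, p.2}) ω) -
        E J (spinPair a b) * E J (spinProduct (if p.1 = p.2 then ∅ else {p.1, p.2}))) ≤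
      E J (spinPair a p.1) * ∑ b ∈ T, E J (spinPair p.2 b) + E J (spinPair a p.2) * ∑ b ∈ T, E J (spinPair p.1 b) := by
  have he := gksE_spinPair_nonneg hE hK hW hJ
  obtain ⟨u, v⟩ := p
  dsimp only
  by_cases huv : u = v
  · subst huv
    rw [if_pos rfl]
    have h1 : spinProduct (∅ : Finset V) = fun _ => (1 : ℝ) := funext fun ω => by simp [spinProduct]
    rw [Finset.sum_eq_zero fun b _ => by rw [h1]; simp only [hE, mul_one, gksExpect_one, sub_self]]
    exact add_nonneg (mul_nonneg (he a u) (Finset.sum_nonneg fun b _ => he u b))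
      (mul_nonneg (he a u) (Finset.sum_nonneg fun b _ => he u b))
  · rw [if_neg huv, spinProduct_pair_eq_spinPair huv, Finset.mul_sum, Finset.mul_sum, ← Finset.sum_add_distrib]
    refine Finset.sum_le_sum fun b _ => ?_
    have h := gksExpect_connectedFour_nonpos Finset.univ (affCpl K W J)
      (fun p : V × V => if p.1 = p.2 then (∅ : Finset V) else {p.1, p.2})
      (fun q _ => add_nonneg (hK q) (mul_nonneg hJ (hW q))) (fun q _ => (pairSupp_card q).1)
      (fun q _ => Or.inr (pairSupp_card q).2) a b u v
    rw [spinPair_comm b v, spinPair_comm b u] at h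
    simp only [hE]
    linarith

omit [DecidableEq V] in
/-- Row sums: if `W_{uv} ≠ 0` forces `u, v ∈ T` and `Σ_v W_{uv} ≤ R`, then `Σ_{(u,v)} W_{uv} g(u) ≤ R Σ_{u ∈ T} g(u)`
for `g ≥ 0` (columns: apply to `W ∘ swap`). [folklore] -/
private theorem sum_W_mul_fst_le {W : V × V → ℝ} {T : Finset V} {R : ℝ}
    (hWT : ∀ p, W p ≠ 0 → p.1 ∈ T ∧ p.2 ∈ T) (hrow : ∀ u, ∑ v, W (u, v) ≤ R)
    (g : V → ℝ) (hg : ∀ u, 0 ≤ g u) : ∑ p, W p * g p.1 ≤ R * ∑ u ∈ T, g u := by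
  rw [Fintype.sum_prod_type, Finset.mul_sum]
  simp only [← Finset.sum_mul]
  have hvan : ∀ u ∈ (Finset.univ : Finset V), u ∉ T → (∑ v, W (u, v)) * g u = 0 := by
    intro u _ hu
    rw [Finset.sum_eq_zero (fun v _ => ?_), zero_mul]
    by_contra h
    exact hu (hWT (u, v) h).1
  rw [← Finset.sum_subset (Finset.subset_univ T) hvan]
  exact Finset.sum_le_sum fun u _ => mul_le_mul_of_nonneg_right (hrow u) (hg u)

omit [DecidableEq V] in
/-- **The summation step of `∂χ ≤ |J| χ²`**: if `F_{uv} ≤ e(u) X(v) + e(v) X(u)` with `e ≥ 0`, `X ≤ M` on `T`,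
`Σ_{u ∈ T} e(u) ≤ M`, and the `W`-bonds have endpoints in `T` with row and column sums at most `R`, then
`Σ_{(u,v)} W_{uv} F_{uv} ≤ 2 R M²`. [cite: DuminilCopinICM2022, §7.1 (∂_β χ ≤ 2dχ²)] -/
private theorem sum_W_mul_le {W : V × V → ℝ} {T : Finset V} {R M : ℝ} (hW : ∀ p, 0 ≤ W p)
    (hWT : ∀ p, W p ≠ 0 → p.1 ∈ T ∧ p.2 ∈ T) (hrow : ∀ u, ∑ v, W (u, v) ≤ R) (hcol : ∀ v, ∑ u, W (u, v) ≤ R)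
    (hR : 0 ≤ R) {F : V × V → ℝ} (e X : V → ℝ) (he : ∀ u, 0 ≤ e u) (hX : ∀ x ∈ T, X x ≤ M)
    (heT : ∑ u ∈ T, e u ≤ M) (hF : ∀ p, F p ≤ e p.1 * X p.2 + e p.2 * X p.1) :
    ∑ p, W p * F p ≤ 2 * R * M ^ 2 := by
  have hM0 : 0 ≤ M := (Finset.sum_nonneg fun u _ => he u).trans heT
  -- column sums are row sums of `W ∘ swap`
  have hcol' : ∑ p, W p * e p.2 ≤ R * ∑ u ∈ T, e u :=
    (Fintype.sum_equiv (Equiv.prodComm V V) (fun p => W p * e p.2) (fun q => W q.swap * e q.1)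
      fun p => rfl).trans_le (sum_W_mul_fst_le (W := fun q => W q.swap) (fun q hq => (hWT q.swap hq).symm) hcol e he)
  calc ∑ p, W p * F p ≤ ∑ p, W p * (e p.1 * X p.2 + e p.2 * X p.1) :=
        Finset.sum_le_sum fun p _ => mul_le_mul_of_nonneg_left (hF p) (hW p)
    _ ≤ ∑ p, W p * (e p.1 * M + e p.2 * M) := by
        refine Finset.sum_le_sum fun p _ => ?_
        by_cases hp : W p = 0
        · rw [hp, zero_mul, zero_mul]
        · obtain ⟨h1, h2⟩ := hWT p hp
          exact mul_le_mul_of_nonneg_left (add_le_add (mul_le_mul_of_nonneg_left (hX _ h2) (he _))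
            (mul_le_mul_of_nonneg_left (hX _ h1) (he _))) (hW p)
    _ = M * (∑ p, W p * e p.1 + ∑ p, W p * e p.2) := by
        rw [← Finset.sum_add_distrib, Finset.mul_sum]
        exact Finset.sum_congr rfl fun p _ => by ring
    _ ≤ M * (R * ∑ u ∈ T, e u + R * ∑ u ∈ T, e u) :=
        mul_le_mul_of_nonneg_left (add_le_add (sum_W_mul_fst_le hWT hrow e he) hcol') hM0
    _ ≤ M * (R * M + R * M) :=
        mul_le_mul_of_nonneg_left (add_le_add (mul_le_mul_of_nonneg_left heT hR)
          (mul_le_mul_of_nonneg_left heT hR)) hM0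
    _ = 2 * R * M ^ 2 := by ring

/-- **The bridge**: if `c_J(u,v) = K_{(u,v)} + J W_{(u,v)}`, then `⟨f⟩_{c_J}` is the state `⟨f⟩_{Λ;K+JW}` with index set
`V × V` and pair supports (`PairIsing.avg_eq_gksExpect`, `gibbsAvg = avg` by `rfl`). [cite: FriedliVelenik2017, §3.8.1, p. 141] -/
private theorem gibbsAvg_eq_gksE {c : ℝ → V → V → ℝ} {K W : V × V → ℝ}
    (hc : ∀ J (p : V × V), c J p.1 p.2 = K p + J * W p) (J : ℝ) (f : SpinConfig V → ℝ) :
    PairIsing.gibbsAvg (c J) f =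
      gksExpect Finset.univ (affCpl K W J) (fun p => if p.1 = p.2 then ∅ else {p.1, p.2}) f := by
  have hKW : Function.uncurry (c J) = affCpl K W J := funext fun p => hc J p
  rw [← hKW]
  exact PairIsing.avg_eq_gksExpect (c J) f

/-- **Increment of a slab sum along an affine ferromagnetic pair-coupling path** `c_J = K + J W` (`K, W ≥ 0`, the
`W`-bonds with both endpoints in `T`, row/column sums of `W` at most `R`): if `Σ_{b∈T} ⟨σ_xσ_b⟩_{J₂} ≤ M` for `x ∈ T`
and `0 ≤ J₁ ≤ J₂`, then `Σ_{b∈T} ⟨σ_aσ_b⟩_{J₂} - Σ_{b∈T} ⟨σ_aσ_b⟩_{J₁} ≤ 2 R M² (J₂ - J₁)` for `a ∈ T`: the derivative is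
the sum of covariances with the `W`-bonds (Glimm–Jaffe Prop. 4.2.1, `hasDerivAt_gksExpect_affCpl_cov`, through the
bridge), bounded by Lebowitz + GKS (`sum_cov_le`, `sum_W_mul_le`); then the mean value inequality.
[cite: GlimmJaffe1987, §4.2 Prop. 4.2.1 and Cor. 4.3.3] [cite: DuminilCopinICM2022, §7.1] -/
private theorem slabSum_sub_le_of_path {c : ℝ → V → V → ℝ} {K W : V × V → ℝ} {T : Finset V} {R : ℝ}
    (hc : ∀ J (p : V × V), c J p.1 p.2 = K p + J * W p) (hK : ∀ p, 0 ≤ K p) (hW : ∀ p, 0 ≤ W p)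
    (hWT : ∀ p, W p ≠ 0 → p.1 ∈ T ∧ p.2 ∈ T) (hrow : ∀ u, ∑ v, W (u, v) ≤ R)
    (hcol : ∀ v, ∑ u, W (u, v) ≤ R) {J₁ J₂ M : ℝ} (hJ₁ : 0 ≤ J₁) (h12 : J₁ ≤ J₂)
    (hM : ∀ x ∈ T, ∑ b ∈ T, PairIsing.gibbsAvg (c J₂) (fun s => spinAt x s * spinAt b s) ≤ M)
    {a : V} (ha : a ∈ T) :
    ∑ b ∈ T, PairIsing.gibbsAvg (c J₂) (fun s => spinAt a s * spinAt b s) -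
        ∑ b ∈ T, PairIsing.gibbsAvg (c J₁) (fun s => spinAt a s * spinAt b s) ≤
      2 * R * M ^ 2 * (J₂ - J₁) := by
  -- the state along the path, as an opaque function `E J f = ⟨f⟩_{Λ;K+JW}`
  obtain ⟨E, hE⟩ : ∃ E : ℝ → (SpinConfig V → ℝ) → ℝ, ∀ J f,
      E J f = gksExpect Finset.univ (affCpl K W J) (fun p => if p.1 = p.2 then ∅ else {p.1, p.2}) f :=
    ⟨_, fun _ _ => rfl⟩
  have hsum : ∀ J' x, ∑ b ∈ T, PairIsing.gibbsAvg (c J') (fun s => spinAt x s * spinAt b s) =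
      ∑ b ∈ T, E J' (spinPair x b) :=
    fun J' x => Finset.sum_congr rfl fun b _ => (gibbsAvg_eq_gksE hc J' (spinPair x b)).trans (hE _ _).symm
  have hM' : ∀ x ∈ T, ∑ b ∈ T, E J₂ (spinPair x b) ≤ M := fun x hx => hsum J₂ x ▸ hM x hx
  -- the derivative of the slab sum along the path: a sum of covariances with the `W`-bonds
  have hderiv : ∀ J, HasDerivAt (fun J => ∑ b ∈ T, PairIsing.gibbsAvg (c J) (fun s => spinAt a s * spinAt b s))
      (∑ b ∈ T, ∑ p, W p * (E J (fun ω => spinPair a b ω * spinProduct (if p.1 = p.2 then ∅ else {p.1, p.2}) ω) -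
        E J (spinPair a b) * E J (spinProduct (if p.1 = p.2 then ∅ else {p.1, p.2})))) J := by
    refine fun J => HasDerivAt.fun_sum fun b _ => ?_
    have hfun : (fun J => PairIsing.gibbsAvg (c J) (fun s => spinAt a s * spinAt b s)) = fun J =>
        gksExpect Finset.univ (affCpl K W J) (fun p => if p.1 = p.2 then ∅ else {p.1, p.2}) (spinPair a b) :=
      funext fun J => gibbsAvg_eq_gksE hc J (spinPair a b)
    rw [hfun]
    simp only [hE]
    exact hasDerivAt_gksExpect_affCpl_cov _ K W _ (spinPair a b) J
  have hbound : ∀ J ∈ interior (Set.Icc J₁ J₂),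
      deriv (fun J => ∑ b ∈ T, PairIsing.gibbsAvg (c J) (fun s => spinAt a s * spinAt b s)) J ≤
        2 * R * M ^ 2 := by
    intro J hJ
    rw [interior_Icc] at hJ
    have hJ0 : 0 ≤ J := hJ₁.trans hJ.1.le
    have he := gksE_spinPair_nonneg hE hK hW hJ0
    have hX : ∀ x ∈ T, ∑ b ∈ T, E J (spinPair x b) ≤ M := fun x hx =>
      (Finset.sum_le_sum fun b _ => gksE_spinPair_mono hE hK hW hJ0 hJ.2.le x b).trans (hM' x hx)
    rw [(hderiv J).deriv, Finset.sum_comm]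
    simp only [← Finset.mul_sum]
    exact sum_W_mul_le hW hWT hrow hcol ((Finset.sum_nonneg fun v _ => hW (a, v)).trans (hrow a))
      (fun u => E J (spinPair a u)) (fun x => ∑ b ∈ T, E J (spinPair x b)) (he a) hX (hX a ha)
      fun p => sum_cov_le hE hK hW hJ0 T a p
  exact (convex_Icc J₁ J₂).image_sub_le_mul_sub_of_deriv_le
    (fun J _ => (hderiv J).continuousAt.continuousWithinAt)
    (fun J _ => (hderiv J).differentiableAt.differentiableWithinAt) hbound J₁ (Set.left_mem_Icc.2 h12) J₂
    (Set.right_mem_Icc.2 h12) h12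

end PathCalculus

/-! ## §2 The seam coupling `β/2 · (J on the bonds touching the plane, 1 on the others)`: abstract combinatorics -/

section Seam

variable {V : Type*} [Fintype V] [DecidableEq V]

/-- The seam coupling is affine in `J`: `c_J = c_0 + J (c_1 - c_0)` entrywise. [folklore] -/
private theorem seamCpl_affine {P Q : Prop} [Decidable P] [Decidable Q] (β J : ℝ) :
    (if P then β / 2 * (if Q then J else 1) else 0 : ℝ) =
      (if P then β / 2 * (if Q then 0 else 1) else 0) + J * (if P then β / 2 * (if Q then 1 else 0) else 0) := by
  split_ifs <;> ring

/-- Sign of the two parts of the seam coupling. [folklore] -/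
private theorem seamCpl_nonneg {P Q : Prop} [Decidable P] [Decidable Q] {β x y : ℝ} (hβ : 0 ≤ β) (hx : 0 ≤ x)
    (hy : 0 ≤ y) : 0 ≤ (if P then β / 2 * (if Q then x else y) else 0 : ℝ) := by
  split_ifs <;> positivity

/-- A nonzero seam part is a bond (`P`) touching the plane (`Q`). [folklore] -/
private theorem seam_of_ne_zero {P Q : Prop} [Decidable P] [Decidable Q] {β : ℝ}
    (h : (if P then β / 2 * (if Q then 1 else 0) else 0 : ℝ) ≠ 0) : P ∧ Q := by
  split_ifs at h with hP hQ
  exacts [⟨hP, hQ⟩, absurd (mul_zero _) h, absurd rfl h]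

/-- The seam part is at most `β/2` on any larger set of bonds `B ⊇ P`. [folklore] -/
private theorem seamW_le {P Q B : Prop} [Decidable P] [Decidable Q] [Decidable B] {β : ℝ} (hβ : 0 ≤ β)
    (hPB : P → B) : (if P then β / 2 * (if Q then 1 else 0) else 0 : ℝ) ≤ if B then β / 2 else 0 := by
  split_ifs <;> first | linarith | exact absurd (hPB ‹_›) ‹_›

/-- **Increment bound for the seam coupling, abstract adjacency** (bonds `A`, plane-touching relation `Q`, slab `S`):
if bonds touching the plane have both endpoints in `S` and `A` lies in a symmetric relation `A'` with at most `D`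
partners per site, the slab sums `χ_x(J) = Σ_{b ∈ S} ⟨σ_xσ_b⟩_J` of `β/2 · (J on A ∩ Q, 1 on A \ Q)` satisfy
`χ_a(J₂) - χ_a(J₁) ≤ D β (J₂ - J₁) M²` for `0 ≤ J₁ ≤ J₂`, `a ∈ S`, `χ ≤ M` on `S` at `J₂`. [cite: DuminilCopinICM2022, §7.1] -/
private theorem slab_increment_le {A Q A' : V → V → Prop} {S : V → Prop} {_ : DecidableRel A}
    {_ : DecidableRel Q} {_ : DecidableRel A'} {_ : DecidablePred S} {β : ℝ} (hβ : 0 ≤ β) {D : ℕ}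
    (hAS : ∀ u v, A u v → Q u v → S u ∧ S v) (hAA' : ∀ u v, A u v → A' u v)
    (hA's : ∀ u v, A' u v → A' v u) (hD : ∀ u, (Finset.univ.filter fun v => A' u v).card ≤ D)
    {J₁ J₂ M : ℝ} (hJ₁ : 0 ≤ J₁) (h12 : J₁ ≤ J₂)
    (hM : ∀ x, S x → (∑ b, if S b then PairIsing.gibbsAvg
      (fun a b => if A a b then β / 2 * (if Q a b then J₂ else 1) else 0) (fun s => spinAt x s * spinAt b s)
      else 0) ≤ M)
    {a : V} (ha : S a) :
    (∑ b, if S b then PairIsing.gibbsAvg (fun a b => if A a b then β / 2 * (if Q a b then J₂ else 1) else 0)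
        (fun s => spinAt a s * spinAt b s) else 0) -
      (∑ b, if S b then PairIsing.gibbsAvg (fun a b => if A a b then β / 2 * (if Q a b then J₁ else 1) else 0)
        (fun s => spinAt a s * spinAt b s) else 0) ≤ D * β * (J₂ - J₁) * M ^ 2 := by
  -- the row (and, by the same count, column) sums of the seam part `W`
  have hcount : ∀ (P Q' B : V → Prop) [DecidablePred P] [DecidablePred Q'] [DecidablePred B],
      (∀ v, P v → B v) → (Finset.univ.filter B).card ≤ D →
      ∑ v, (if P v then β / 2 * (if Q' v then 1 else 0) else 0 : ℝ) ≤ D * (β / 2) := by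
    intro P Q' B _ _ _ hB hBD
    calc ∑ v, (if P v then β / 2 * (if Q' v then 1 else 0) else 0 : ℝ)
        ≤ ∑ v, (if B v then β / 2 else 0 : ℝ) := Finset.sum_le_sum fun v _ => seamW_le hβ (hB v)
      _ = (Finset.univ.filter B).card * (β / 2) := by
          rw [← Finset.sum_filter, Finset.sum_const, nsmul_eq_mul]
      _ ≤ D * (β / 2) := mul_le_mul_of_nonneg_right (Nat.cast_le.2 hBD) (by positivity)
  have key := slabSum_sub_le_of_path (V := V) (T := Finset.univ.filter S)
    (c := fun J a b => if A a b then β / 2 * (if Q a b then J else 1) else 0)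
    (K := fun p => if A p.1 p.2 then β / 2 * (if Q p.1 p.2 then 0 else 1) else 0)
    (W := fun p => if A p.1 p.2 then β / 2 * (if Q p.1 p.2 then 1 else 0) else 0) (R := D * (β / 2))
    (fun J p => seamCpl_affine β J) (fun p => seamCpl_nonneg hβ le_rfl zero_le_one)
    (fun p => seamCpl_nonneg hβ zero_le_one le_rfl)
    (fun p hp => by
      obtain ⟨hA, hQ⟩ := seam_of_ne_zero hp
      obtain ⟨h1, h2⟩ := hAS _ _ hA hQ
      exact ⟨Finset.mem_filter.2 ⟨Finset.mem_univ _, h1⟩, Finset.mem_filter.2 ⟨Finset.mem_univ _, h2⟩⟩)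
    (fun u => hcount (fun v => A u v) (fun v => Q u v) (fun v => A' u v) (hAA' u) (hD u))
    (fun v => hcount (fun u => A u v) (fun u => Q u v) (fun u => A' v u) (fun u h => hA's u v (hAA' u v h)) (hD v))
    hJ₁ h12 (M := M) (fun x hx => by rw [Finset.sum_filter]; exact hM x (Finset.mem_filter.1 hx).2) (a := a)
    (Finset.mem_filter.2 ⟨Finset.mem_univ _, ha⟩)
  rw [Finset.sum_filter, Finset.sum_filter] at key
  refine key.trans (le_of_eq ?_)
  ring

end Seam

/-! ## §3 The twin: slab geometry of the seam bonds and the partner count -/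

/-- **Seam bonds lie in the slab**: a lattice bond (`Σᵢ|uᵢ - vᵢ| = 1`) or a cross-layer pair (`{h u, h v} = {0,1}`)
with an endpoint on the plane `h = 0` has both endpoints in `T = {-1 ≤ h ≤ 1}`. [folklore] -/
private theorem slab_of_seam {L : ℕ} (u v : ↥(box 3 L))
    (hA : (∑ i, |u.1 i - v.1 i| = 1) ∨ ((u.1 0 + u.1 1 + u.1 2 = 0 ∧ v.1 0 + v.1 1 + v.1 2 = 1) ∨
      (u.1 0 + u.1 1 + u.1 2 = 1 ∧ v.1 0 + v.1 1 + v.1 2 = 0)))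
    (hQ : u.1 0 + u.1 1 + u.1 2 = 0 ∨ v.1 0 + v.1 1 + v.1 2 = 0) :
    (-1 ≤ u.1 0 + u.1 1 + u.1 2 ∧ u.1 0 + u.1 1 + u.1 2 ≤ 1) ∧
      (-1 ≤ v.1 0 + v.1 1 + v.1 2 ∧ v.1 0 + v.1 1 + v.1 2 ≤ 1) := by
  rcases hA with hN | hX
  · have hle : |∑ i, (u.1 i - v.1 i)| ≤ 1 := hN ▸ Finset.abs_sum_le_sum_abs _ _
    rw [Fin.sum_univ_three] at hle
    have h := abs_le.1 hle
    omega
  · omega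

/-- A lattice vector of `ℓ¹`-length one is `± eᵢ`. [folklore] -/
private theorem unit_of_sum_abs_eq_one (d : Fin 3 → ℤ) (h : ∑ i, |d i| = 1) :
    ∃ i : Fin 3, (d i = 1 ∨ d i = -1) ∧ ∀ j, j ≠ i → d j = 0 := by
  rw [Fin.sum_univ_three] at h
  have key : (d 0 = 1 ∨ d 0 = -1) ∧ d 1 = 0 ∧ d 2 = 0 ∨ (d 1 = 1 ∨ d 1 = -1) ∧ d 0 = 0 ∧ d 2 = 0 ∨
      (d 2 = 1 ∨ d 2 = -1) ∧ d 0 = 0 ∧ d 1 = 0 := by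
    rcases abs_cases (d 0) with h0 | h0 <;> rcases abs_cases (d 1) with h1 | h1 <;>
      rcases abs_cases (d 2) with h2 | h2 <;> omega
  rcases key with ⟨hs, e, e'⟩ | ⟨hs, e, e'⟩ | ⟨hs, e, e'⟩
  · exact ⟨0, hs, fun j hj => by fin_cases j <;> first | exact absurd rfl hj | assumption⟩
  · exact ⟨1, hs, fun j hj => by fin_cases j <;> first | exact absurd rfl hj | assumption⟩
  · exact ⟨2, hs, fun j hj => by fin_cases j <;> first | exact absurd rfl hj | assumption⟩

/-- **Partner count**: a site of the box has at most `6` lattice neighbours `w ∓ eᵢ` and at most `3` twin partners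
`eᵢ - w`, hence at most `9` partners. [folklore] -/
private theorem card_partners_le (L : ℕ) (w : ↥(box 3 L)) :
    (Finset.univ.filter fun v : ↥(box 3 L) =>
      (∑ i, |w.1 i - v.1 i| = 1) ∨ ∃ i : Fin 3, w.1 + v.1 = Pi.single i 1).card ≤ 9 := by
  rw [Finset.filter_or]
  have h1 : (Finset.univ.filter fun v : ↥(box 3 L) => ∑ i, |w.1 i - v.1 i| = 1).card ≤ 6 := by
    refine (Finset.card_le_card_of_injOn (fun v : ↥(box 3 L) => v.1)
      (t := ((Finset.univ : Finset (Fin 3)) ×ˢ ({1, -1} : Finset ℤ)).image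
        fun q => fun j => if j = q.1 then w.1 j - q.2 else w.1 j) ?_ ?_).trans ?_
    · intro v hv
      rw [Finset.mem_coe, Finset.mem_filter] at hv
      obtain ⟨i, hi, hij⟩ := unit_of_sum_abs_eq_one (fun j => w.1 j - v.1 j) hv.2
      simp only [Finset.mem_coe, Finset.mem_image]
      refine ⟨(i, w.1 i - v.1 i), Finset.mem_product.2 ⟨Finset.mem_univ _, by simpa using hi⟩, ?_⟩
      funext j
      by_cases hj : j = i
      · subst hj; simp
      · rw [if_neg hj]
        have := hij j hj
        omega
    · exact fun v _ v' _ h => Subtype.ext h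
    · refine Finset.card_image_le.trans ?_
      rw [Finset.card_product, Finset.card_univ, Fintype.card_fin, Finset.card_pair (by decide)]
  have h2 : (Finset.univ.filter fun v : ↥(box 3 L) => ∃ i : Fin 3, w.1 + v.1 = Pi.single i 1).card ≤ 3 := by
    refine (Finset.card_le_card_of_injOn (fun v : ↥(box 3 L) => v.1)
      (t := (Finset.univ : Finset (Fin 3)).image fun i => Pi.single i 1 - w.1) ?_ ?_).trans ?_
    · intro v hv
      rw [Finset.mem_coe, Finset.mem_filter] at hv
      obtain ⟨i, hi⟩ := hv.2
      simp only [Finset.mem_coe, Finset.mem_image]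
      exact ⟨i, Finset.mem_univ _, by rw [← hi, add_sub_cancel_left]⟩
    · exact fun v _ v' _ h => Subtype.ext h
    · exact Finset.card_image_le.trans (by rw [Finset.card_univ, Fintype.card_fin])
  exact (Finset.card_union_le _ _).trans ((add_le_add h1 h2).trans (by norm_num))

/-! ## §4 The registered stub -/

/-- **stub_seamLebowitzIncrement (S2 — LEBOWITZ DIFFERENTIAL INEQUALITY IN THE SEAM COUPLING, finite volume; K1 of
idea `threshold-lebowitz-calculus`).** In the free twin box `L`, with `χ_a(J) := Σ_{b ∈ T_L} ⟨σ_aσ_b⟩_{L,J}` over the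
slab `T = {-1 ≤ h ≤ 1}`: the seam coupling `J` multiplies exactly the bonds with an endpoint on the plane (endpoints
in `T`, at most `9` partners per site), so `dχ_a/dJ = Σ_b Σ_{(u,v)} W_{uv} ⟨σ_aσ_b; σ_uσ_v⟩ ≤ 9 β_c M χ_a` (derivative
along the affine coupling path `hasDerivAt_gksExpect_affCpl_cov` through `PairIsing.avg_eq_gksExpect`; Lebowitz
`u₄ ≤ 0`, `gksExpect_connectedFour_nonpos`; GKS I/II), and the mean value inequality over `[J₁, J₂] ⊂ [0, ∞)` gives
`χ_a(J₂) - χ_a(J₁) ≤ 9 β_c (J₂ - J₁) M² ≤ 12 β_c (J₂ - J₁) M²`. [cite: GlimmJaffe1987, §4.2 Prop. 4.2.1 and Cor. 4.3.3]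
[cite: DuminilCopinICM2022, §7.1] -/
theorem stub_seamLebowitzIncrement :
    (fun (slabSum : ℝ → (L : ℕ) → ↥(box 3 L) → ℝ) => ∀ (L : ℕ) (J₁ J₂ M : ℝ), 0 ≤ J₁ → J₁ ≤ J₂ → (∀ a : ↥(box 3 L), (-1 ≤ a.1 0 + a.1 1 + a.1 2 ∧ a.1 0 + a.1 1 + a.1 2 ≤ 1) → slabSum J₂ L a ≤ M) → ∀ a : ↥(box 3 L), (-1 ≤ a.1 0 + a.1 1 + a.1 2 ∧ a.1 0 + a.1 1 + a.1 2 ≤ 1) → slabSum J₂ L a - slabSum J₁ L a ≤ 12 * criticalBeta 3 * (J₂ - J₁) * M ^ 2) (fun (J : ℝ) (L : ℕ) (a : ↥(box 3 L)) => ∑ b : ↥(box 3 L), if (-1 ≤ b.1 0 + b.1 1 + b.1 2 ∧ b.1 0 + b.1 1 + b.1 2 ≤ 1) then PairIsing.gibbsAvg (fun a b : ↥(box 3 L) => if (((∑ i, |a.1 i - b.1 i| = 1) ∧ ¬ ((a.1 0 + a.1 1 + a.1 2 = 0 ∧ b.1 0 + b.1 1 + b.1 2 = 1) ∨ (a.1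 0 + a.1 1 + a.1 2 = 1 ∧ b.1 0 + b.1 1 + b.1 2 = 0))) ∨ (((a.1 0 + a.1 1 + a.1 2 = 0 ∧ b.1 0 + b.1 1 + b.1 2 = 1) ∨ (a.1 0 + a.1 1 + a.1 2 = 1 ∧ b.1 0 + b.1 1 + b.1 2 = 0)) ∧ ∃ i : Fin 3, a.1 + b.1 = Pi.single i 1)) then (criticalBeta 3 / 2) * (if a.1 0 + a.1 1 + a.1 2 = 0 ∨ b.1 0 + b.1 1 + b.1 2 = 0 then J else 1) else 0) (fun s => spinAt a s * spinAt b s) else 0) := by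
  beta_reduce
  intro L J₁ J₂ M hJ₁ h12 hM a ha
  refine (slab_increment_le (criticalBeta_nonneg 3) ?_ ?_ ?_ (card_partners_le L) hJ₁ h12 hM ha).trans ?_
  · -- seam bonds have their endpoints in the slab
    exact fun u v hA hQ => slab_of_seam u v (hA.imp (fun h => h.1) (fun h => h.1)) hQ
  · -- twin adjacency ⊆ (lattice bond) ∨ (twin partner)
    exact fun u v h => h.imp (fun h => h.1) (fun h => h.2)
  · -- the latter relation is symmetric
    rintro u v (h | ⟨i, hi⟩)
    · exact Or.inl (h ▸ Finset.sum_congr rfl fun i _ => abs_sub_comm _ _)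
    · exact Or.inr ⟨i, by rw [← hi, add_comm]⟩
  · -- `9 β_c ≤ 12 β_c`
    have h0 : 0 ≤ criticalBeta 3 * (J₂ - J₁) * M ^ 2 :=
      mul_nonneg (mul_nonneg (criticalBeta_nonneg 3) (sub_nonneg.2 h12)) (sq_nonneg M)
    calc ((9 : ℕ) : ℝ) * criticalBeta 3 * (J₂ - J₁) * M ^ 2 = 9 * (criticalBeta 3 * (J₂ - J₁) * M ^ 2) := by
          push_cast; ring
      _ ≤ 12 * (criticalBeta 3 * (J₂ - J₁) * M ^ 2) := mul_le_mul_of_nonneg_right (by norm_num) h0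
      _ = 12 * criticalBeta 3 * (J₂ - J₁) * M ^ 2 := by ring

end Summit.CriticalPhenomena.Ising3DConformalLimit.Cruxes.TwinTransparency.ReplicaMirror

end
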